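import Mathlib
import HarnessLib
import Summits.HubbardSuperconductivity.HubbardSuperconductivity.Theorems.KLProgrammeKLRegimeSplitTwoLegCoreTFromExports
import Summits.HubbardSuperconductivity.HubbardSuperconductivity.Theorems.KLProgrammeKLRegimeSplitTwoLegScaleZeroSizes

/-!
# Route `KLProgramme` — gen-5 ENGINE child (`EngineP4 klPredsV14 klWindowC`), stub `stub_twoLeg_scale0`: the slot core `TwoLegCoreT hist … K 0`
# ASSEMBLED from the expansion's scale-`0` exports — the companion of `twoLegCoreT_succ_of_exports`

Cell `gate-hubbard-kl`, seat p1b (g6).  **`twoLegCoreT_zero_of_exports`**: for every `R` (`Gfr ≥ 0`) there are `c₃, U₀, D_lip, D_sl > 0` such that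
in the regime, for `μ ∈ klWindowC` and an admissible `K`, every history `hist`, packages `G P Q` and volumes, the scale-`0` exports imply
`TwoLegCoreT L M hist G P Q R β U μ K 0`:
* (E3a-T1) the pinned spatial moments `Mˢ k` (`k ≤ 4`) of the scale-`0` unsectorised position two-leg kernels `W^{(0)}`, cutoff numerals `X`, and the
  FIT of the order-resolved bound (`…TwoLegScaleZeroSizes`: frame `C²` size `A = 2Gfr₀|U| + 2Gfr₁U² + Gfr₂c/log 4`, `klCurveD1/2`) into `twoLegBar G Q U j 0`;
* (E3c-T) the gradient `b₀` of `evalM S_0^K − evalM K` and the RESPONSE MODULUS `ρ₀` of `T^K = S_0^K − K` against every admissible `K′`, with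
  `ρ₀ + b₀/D_lip ≤ lipBar G Q U 0` (`frameLipschitzFnT_zero_of_responses`);
* (E3d/e) the first spatial / temporal moments of `W^{(0)}` with `2Mˢ₁ ≤ cz|U|·D_sl`, `2Mᵗ ≤ cz|U|`.
Proof only (plumbing); nothing about the model is asserted.  References: BGM 2006 §2.4 [cite: BenfattoGiulianiMastropietro2006].
-/

noncomputable section

namespace Summit.HubbardSuperconductivity.HubbardSuperconductivity.Theorems.KLRegimeSplit

set_option linter.dupNamespace false -- summit = problem name (single-conjunct summit), D-0017

open Real Finset
open Literature.MathematicalPhysics.QuantumLattice Literature.Probability.LatticeModels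
open Summit.HubbardSuperconductivity.HubbardSuperconductivity.Theorems.KLProgrammeLegKernels
open Summit.HubbardSuperconductivity.HubbardSuperconductivity.Theorems.PerturbedFermiCurve
open Summit.HubbardSuperconductivity.HubbardSuperconductivity.Theorems.TwoLegFourier

/-- **`TwoLegCoreT hist … K 0` FROM THE SCALE-`0` EXPORTS** (see the module docstring; all fits are hypotheses). -/
theorem twoLegCoreT_zero_of_exports (R : RenConsts) (hR : ∀ j, 0 ≤ R.Gfr j) :
    ∃ c₃ : ℝ, 0 < c₃ ∧ ∃ U₀ : ℝ, 0 < U₀ ∧ ∃ Dlip : ℝ, 0 < Dlip ∧ ∃ Dsl : ℝ, 0 < Dsl ∧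
      ∀ c : ℝ, 0 < c → c ≤ c₃ → ∀ U : ℝ, 0 < U → U ≤ U₀ → ∀ β : ℝ, klBetaMin ≤ β → β ≤ Real.exp (c / U ^ 2) →
      ∀ μ ∈ klWindowC, ∀ K : TrigPolyC4v, FrameOK R U (nScales β) μ K →
        ∀ (L M : ℕ) [NeZero L] [NeZero M] (hist : TrigPolyC4v → ℕ → Prop) (G : GeoConsts) (P : SplitConsts) (Q : EngConsts)
          -- (E3a-T1) exports at scale 0
          (Ms : ℕ → ℝ) (X : ℝ),
          (∀ k ≤ 4, ∀ (σ : Fin 2) (x₀ : SpaceTimeIdx L M), imagTimeWeight β M *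
            ∑ x ∈ (univ : Finset (Fin 2 → SpaceTimeIdx L M)).filter (fun x => x 0 = x₀),
              (1 + ((((x 1).2 - (x 0).2) 0).valMinAbs.natAbs : ℝ) + ((((x 1).2 - (x 0).2) 1).valMinAbs.natAbs : ℝ)) ^ k *
                ‖sectorisedKernel L M β (trivialMultiplier L M) (klEffectiveAction L M β U μ K klE0 0) 2
                  (![((0, σ), 0), ((0, σ), 1)] : Fin 2 → SectorLeg 1) x‖ ≤ Ms k) →
          (∀ l ≤ 2, ∀ x : ℝ, ‖iteratedFDeriv ℝ l salmhoferCutoff x‖ ≤ X) →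
          (∀ j ≤ 2, (if j = 0 then 2 * Ms 0 + (2 * R.Gfr 0 * |U| + 2 * R.Gfr 1 * U ^ 2 + R.Gfr 2 * (c / Real.log 4)) else 0) +
              (j.factorial : ℝ) ^ 2 * (2 * j.factorial * X * 200 ^ j) *
                (if j = 0 then 2 * (2 * Ms 0 + (2 * R.Gfr 0 * |U| + 2 * R.Gfr 1 * U ^ 2 + R.Gfr 2 * (c / Real.log 4))) else
                  (2 * π + 1) * ((2 * Ms 1 + (2 * R.Gfr 0 * |U| + 2 * R.Gfr 1 * U ^ 2 + R.Gfr 2 * (c / Real.log 4))) * klCurveD1) +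
                    (if j = 2 then (2 * Ms 2 + (2 * R.Gfr 0 * |U| + 2 * R.Gfr 1 * U ^ 2 + R.Gfr 2 * (c / Real.log 4))) * klCurveD1 ^ 2 +
                      (2 * Ms 1 + (2 * R.Gfr 0 * |U| + 2 * R.Gfr 1 * U ^ 2 + R.Gfr 2 * (c / Real.log 4))) * klCurveD2 else 0)) *
                (4 + max 1 (((j - 1).factorial : ℝ) / (8 / 5))) ^ j ≤ twoLegBar G Q U j 0) →
          -- (E3c-T) exports at scale 0 (frame vertex cancelled: `T^K = S_0^K − K`)
          ∀ (b₀ ρ₀ : ℝ), 0 ≤ b₀ →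
          (∀ q : Momentum, ‖fderiv ℝ (fun q : Momentum =>
            evalM (symInterp L (klLocSelfEnergyRe L M β U μ K 0)) q - evalM K q) q‖ ≤ b₀) →
          (∀ K' : TrigPolyC4v, FrameOK R U (klTempScaleIdx β klE0) μ K' → ∀ θ : ℝ,
            |((symInterp L (klLocSelfEnergyRe L M β U μ K 0)).eval (klFermiPoint μ K' θ) - K.eval (klFermiPoint μ K' θ)) -
              ((symInterp L (klLocSelfEnergyRe L M β U μ K' 0)).eval (klFermiPoint μ K' θ) - K'.eval (klFermiPoint μ K' θ))| ≤
              ρ₀ * frameDist K K') →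
          ρ₀ + b₀ / Dlip ≤ lipBar G Q U 0 →
          -- (E3d/e) exports at scale 0
          ∀ (Ms₁ Mt : ℝ), 0 ≤ Ms₁ →
          (∀ (σ : Fin 2) (x₀ : SpaceTimeIdx L M), imagTimeWeight β M *
            ∑ x ∈ (univ : Finset (Fin 2 → SpaceTimeIdx L M)).filter (fun x => x 0 = x₀),
              (1 + ((((x 1).2 - (x 0).2) 0).valMinAbs.natAbs : ℝ) + ((((x 1).2 - (x 0).2) 1).valMinAbs.natAbs : ℝ)) ^ 1 *
                ‖sectorisedKernel L M β (trivialMultiplier L M) (klEffectiveAction L M β U μ K klE0 0) 2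
                  (![((0, σ), 0), ((0, σ), 1)] : Fin 2 → SectorLeg 1) x‖ ≤ Ms₁) →
          (∀ (σ : Fin 2) (x₀ : SpaceTimeIdx L M), imagTimeWeight β M *
            ∑ x ∈ (univ : Finset (Fin 2 → SpaceTimeIdx L M)).filter (fun x => x 0 = x₀),
              imagTimeWeight β M * (circDist (2 * M) (x 0).1.val (x 1).1.val : ℝ) *
                ‖sectorisedKernel L M β (trivialMultiplier L M) (klEffectiveAction L M β U μ K klE0 0) 2
                  (![((0, σ), 0), ((0, σ), 1)] : Fin 2 → SectorLeg 1) x‖ ≤ Mt) →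
          2 * Ms₁ ≤ R.cz * |U| * Dsl → 2 * Mt ≤ R.cz * |U| →
            TwoLegCoreT L M hist G P Q R β U μ K 0 := by
  obtain ⟨c₁, hc₁, U₁, hU₁, hsm⟩ := twoLegPieceFn_eval_smooth_symmetric_of_frameOK R hR
  obtain ⟨c₂, hc₂, U₂, hU₂, Dlip, hDlip, hlip⟩ := frameLipschitzFnT_zero_of_responses R hR
  obtain ⟨c₄, hc₄, U₄, hU₄, Dsl, hDsl, hsl⟩ := twoLegSlopes_of_frameOK_regime_of_position_moments R hR
  have hC3 := klCurveC3_pos hR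
  have hU0 := klCurveU0_pos hR
  refine ⟨min (min c₁ c₂) (min c₄ (klCurveC3 R)), lt_min (lt_min hc₁ hc₂) (lt_min hc₄ hC3),
    min (min U₁ U₂) (min U₄ (klCurveU0 R)), lt_min (lt_min hU₁ hU₂) (lt_min hU₄ hU0), Dlip, hDlip, Dsl, hDsl, ?_⟩
  intro c hc hcle U hU hUle β hβmin hβc μ hμ K hK L M _ _ hist G P Q Ms X hMs hX hfitS b₀ ρ₀ hb₀ hg₀ hr₀ hfitL
    Ms₁ Mt hMs₁0 hMs₁ hMt hfit1 hfit2
  have hc1 : c ≤ c₁ := hcle.trans ((min_le_left _ _).trans (min_le_left _ _))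
  have hc2 : c ≤ c₂ := hcle.trans ((min_le_left _ _).trans (min_le_right _ _))
  have hc4 : c ≤ c₄ := hcle.trans ((min_le_right _ _).trans (min_le_left _ _))
  have hcC : c ≤ klCurveC3 R := hcle.trans ((min_le_right _ _).trans (min_le_right _ _))
  have hU1 : U ≤ U₁ := hUle.trans ((min_le_left _ _).trans (min_le_left _ _))
  have hU2 : U ≤ U₂ := hUle.trans ((min_le_left _ _).trans (min_le_right _ _))
  have hU4 : U ≤ U₄ := hUle.trans ((min_le_right _ _).trans (min_le_left _ _))
  have hUC : U ≤ klCurveU0 R := hUle.trans ((min_le_right _ _).trans (min_le_right _ _))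
  refine ⟨⟨?_, fun j hj q => ?_⟩, ?_, ?_⟩
  · have h := hsm c hc hc1 U hU hU1 β hβmin hβc μ hμ μ K hK L M 0
    exact_mod_cast h.2 4
  · exact (twoLegPieceFn_eval_zero_tier1_size_le (L := L) (M := M) hR hc hcC hU hUC hβmin hβc hμ hK hMs hj
      (fun l hl x => hX l (hl.trans hj) x) q).trans (hfitS j hj)
  · exact hlip c hc hc2 U hU hU2 β hβmin hβc μ hμ K hK L M hist G Q b₀ ρ₀ hb₀ hg₀ hr₀ hfitL
  · exact hsl c hc hc4 U hU hU4 β hβmin hβc μ hμ K hK L M 0 Ms₁ Mt hMs₁0 hMs₁ hMt hfit1 hfit2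

end Summit.HubbardSuperconductivity.HubbardSuperconductivity.Theorems.KLRegimeSplit

end
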